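import Summits.SmoothPoincare4.SmoothPoincare4.Theorems.ConvexBisectionAcyclicBisectionExistsCrossingCount
import Summits.SmoothPoincare4.SmoothPoincare4.Theorems.ConvexBisectionAcyclicBisectionExistsCrossingRegularLevel
import Summits.SmoothPoincare4.SmoothPoincare4.Theorems.ConvexBisectionAcyclicBisectionExistsChartCrossingSigns
import Summits.SmoothPoincare4.SmoothPoincare4.Theorems.ConvexBisectionAcyclicBisectionExistsCrossingNumberShadow
import HarnessLib

/-!
# Antisymmetry of crossing numbers of two positively charted page curves: (R1)
(wave 5, brick X7-3 = the symmetry statement (R1) `crossingNumber_symm` for the missing lemma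
`crossingNumber_eq_stdSymp` of node N1a of stub `stub_modelsOnFibred_of_reach` = NF4, line
`modp-braid-orbits`, crux `ConvexBisection.AcyclicBisectionExists`, item stmt-SmoothPoincare4-10508;
registered sub-goal `helper_crossingNumber_symm`)

Z6-REPORT §3 (R1): for two page curves `a`, `b` of `page g c` with annulus charts `φ`, `ψ`
satisfying the six hypotheses of node N1a (smooth, `1`-periodic, core, in the page, injective on
the strip, positively oriented),

  **`crossingNumber φ b = −crossingNumber ψ a`**  (`crossingNumber_symm`).

Proof, along the route (i)–(v) of Z6 §3 with the landed bricks: (ii) a regular level `k` of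
`f u = height ψ (a e^{2πiu})` with finitely many transversal solutions `S ⊂ (0, 1)`
(`exists_regular_level`, X7-2); (iv) `crossingNumber ψ a = Σ_{u ∈ S} sign f' u`
(`crossingNumber_eq_sum_sign`, X7-1); (iii) `crossingNumber φ b = crossingNumber φ L` for the level
loop `L (e^{2πit}) = ψ (u₀ + t, k)`, `u₀` chosen off the finitely many abscissae of the crossings
(`crossingNumber_eq_of_loop_family`, Z6-3); (iv) again, `crossingNumber φ L = Σ_{v ∈ S'} sign g' v`
for `g v = height φ (ψ (u₀ + v, k))` at the level `0`, over the set `S'` of abscissae `v` of the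
same crossing points `a (e^{2πiu}) = ψ (u₀ + v, k)` (a bijection `u ↔ v` by injectivity of both
charts; transition maps `contDiffAt_height_comp_chart`, Y4-6, for the regularity of `g`); (v) the
sign rule `helper_crossing_signs` (Y4-7): `sign g' v = −sign f' u` at each crossing.
Everything is proved; no definitions, no named facts, no `sorry`.  References: B. Farb,
D. Margalit, *A primer on mapping class groups* (2012), §6.1 [FarbMargalit2012]; W. Fulton,
*Algebraic Topology: A First Course* (1995), §3 [Fulton1995].
-/

noncomputable section

set_option linter.dupNamespace false

open scoped Manifold ContDiff Topology Real
open Set Function Metric Filter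
open Literature.Topology.FourManifolds Literature.Topology.FourManifolds.LefschetzBase

namespace Summit.SmoothPoincare4.SmoothPoincare4.Theorems.AcyclicBisectionExists.ModpBraidOrbits

variable {g : ℕ} {c : ℂ} {φ ψ : ℝ × ℝ → Base g} {a b : sphere (0 : EuclideanSpace ℝ (Fin 2)) 1 → Base g}

/-- An integer of real absolute value `< 1` is `0`. [folklore] -/
theorem int_eq_zero_of_abs_cast_lt_one {n : ℤ} (h : |(n : ℝ)| < 1) : n = 0 := by
  have : |n| < 1 := by exact_mod_cast h
  exact Int.abs_lt_one_iff.1 this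

/-- The opposite-sign rule turns the sign indicator into its negative. [folklore] -/
theorem ite_sign_eq_neg {β δ : ℝ} (h : (0 < β ↔ δ < 0) ∧ (β < 0 ↔ 0 < δ) ∧ (β = 0 ↔ δ = 0))
    (hδ : δ ≠ 0) : (if 0 < β then (1 : ℤ) else -1) = -(if 0 < δ then (1 : ℤ) else -1) := by
  by_cases hd : 0 < δ
  · rw [if_pos hd, if_neg (fun hb => lt_asymm hd (h.1.1 hb))]
  · rw [if_neg hd, if_pos (h.1.2 (lt_of_le_of_ne (not_lt.1 hd) hδ))]
    norm_num

/-- **(R1) Antisymmetry of crossing numbers.**  For page curves `a`, `b` of `page g c` with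
annulus charts `φ`, `ψ` satisfying the six hypotheses of node N1a,
`crossingNumber φ b = −crossingNumber ψ a`. [cite: FarbMargalit2012, §6.1] -/
theorem crossingNumber_symm (hc : ‖c‖ = 1) (ha : Continuous a) (hb : Continuous b)
    (hφs : ContMDiff 𝓘(ℝ, ℝ × ℝ) (𝓡∂ 4) ∞ φ) (hφ1 : ∀ u r, φ (u + 1, r) = φ (u, r))
    (hφa : ∀ u, φ (u, 0) = a (circlePt u)) (hφp : ∀ p, φ p ∈ page g c)
    (hφi : InjOn φ (Ico (0 : ℝ) 1 ×ˢ Ioo (-1 : ℝ) 1))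
    (hφo : ∀ u r, r ∈ Ioo (-1 : ℝ) 1 →
      0 < inner ℝ (deriv (fun r' => (φ (u, r')).1) r) (cplxJ (deriv (fun u' => (φ (u', r)).1) u)))
    (hψs : ContMDiff 𝓘(ℝ, ℝ × ℝ) (𝓡∂ 4) ∞ ψ) (hψ1 : ∀ u r, ψ (u + 1, r) = ψ (u, r))
    (hψb : ∀ u, ψ (u, 0) = b (circlePt u)) (hψp : ∀ p, ψ p ∈ page g c)
    (hψi : InjOn ψ (Ico (0 : ℝ) 1 ×ˢ Ioo (-1 : ℝ) 1))
    (hψo : ∀ u r, r ∈ Ioo (-1 : ℝ) 1 →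
      0 < inner ℝ (deriv (fun r' => (ψ (u, r')).1) r) (cplxJ (deriv (fun u' => (ψ (u', r)).1) u))) :
    crossingNumber φ b = -crossingNumber ψ a := by
  classical
  have hφc : Continuous φ := hφs.continuous
  have hψc : Continuous ψ := hψs.continuous
  have hac : ∀ θ, a θ ∈ page g c := core_mem_page hφa hφp
  have h00 : (0 : ℝ) ∈ Ioo (-1 : ℝ) 1 := by norm_num
  -- (ii) a regular level `k` of `f u = height ψ (φ (u, 0))`, solutions `S ⊂ (0, 1)`
  obtain ⟨k, hk, S, hS, hlev, hreg⟩ :=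
    exists_regular_level hc hφs hφ1 hφp hψs hψ1 hψp hψi hψo (ε := 1 / 4) (by norm_num)
  have hk2 : k ∈ Ioo (-(1 / 2) : ℝ) (1 / 2) := ⟨by linarith [hk.1], by linarith [hk.2]⟩
  have hk1 : k ∈ Ioo (-1 : ℝ) 1 := ⟨by linarith [hk.1], by linarith [hk.2]⟩
  have hSk : ∀ u ∈ S, φ (u, 0) ∈ ψ '' (univ ×ˢ Ioo (-1 : ℝ) 1) ∧ height ψ (φ (u, 0)) = k :=
    fun u hu => (hlev u ⟨(hS u hu).1.le, (hS u hu).2.le⟩).2 hu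
  -- (iv) on the `ψ`-side: `crossingNumber ψ a = Σ sign f'`
  have hfa : (fun u => height ψ (φ (u, 0))) = fun u => height ψ (a (circlePt u)) :=
    funext fun u => by rw [hφa]
  have hcountA : crossingNumber ψ a =
      ∑ u ∈ S, (if 0 < deriv (fun u => height ψ (φ (u, 0))) u then (1 : ℤ) else -1) := by
    rw [hfa]
    refine crossingNumber_eq_sum_sign hc hψc hψ1 hψp hψi ha hac hk2 S hS (fun u hu => ?_)
      (fun u hu => ?_)
    · rw [← hφa]; exact hlev u hu
    · rw [← hfa]; exact hreg u hu
  -- the abscissae in `ψ` of the crossing points, and a free abscissa `u₀`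
  obtain ⟨vA, hvA⟩ : ∃ vA : ℝ → ℝ, ∀ u, vA u = (prelift ψ (φ (u, 0))).1 := ⟨_, fun _ => rfl⟩
  have hvAk : ∀ u ∈ S, ψ (vA u, k) = φ (u, 0) := by
    intro u hu
    obtain ⟨-, hpψ⟩ := prelift_spec (hSk u hu).1
    have e : (prelift ψ (φ (u, 0))).2 = k := (hSk u hu).2
    rw [hvA, ← e]
    exact hpψ
  obtain ⟨u₀, hu₀, hu₀S⟩ := (Set.Ioo_infinite (show (0 : ℝ) < 1 by norm_num)).exists_notMem_finset
    (S.image fun u => Int.fract (vA u))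
  have hu₀f : Int.fract u₀ = u₀ := Int.fract_eq_self.2 ⟨hu₀.1.le, hu₀.2⟩
  -- the abscissae `v` of the crossing points on the shifted level loop `v ↦ ψ (u₀ + v, k)`
  obtain ⟨w, hw⟩ : ∃ w : ℝ → ℝ, ∀ u, w u = Int.fract (vA u - u₀) := ⟨_, fun _ => rfl⟩
  have hcross : ∀ u ∈ S, ψ (u₀ + w u, k) = φ (u, 0) := by
    intro u hu
    rw [hw, Int.fract, show u₀ + (vA u - u₀ - ((⌊vA u - u₀⌋ : ℤ) : ℝ)) =
      vA u + ((-⌊vA u - u₀⌋ : ℤ) : ℝ) by push_cast; ring, chart_periodic_int hψ1]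
    exact hvAk u hu
  have hwI : ∀ u ∈ S, w u ∈ Ioo (0 : ℝ) 1 := by
    intro u hu
    refine ⟨lt_of_le_of_ne (by rw [hw]; exact Int.fract_nonneg _) fun h0 => hu₀S ?_,
      by rw [hw]; exact Int.fract_lt_one _⟩
    rw [hw] at h0
    have e : vA u - u₀ = ((⌊vA u - u₀⌋ : ℤ) : ℝ) := by
      have := Int.fract_add_floor (vA u - u₀); linarith
    refine Finset.mem_image.2 ⟨u, hu, ?_⟩
    rw [← hu₀f, show u₀ = vA u - ((⌊vA u - u₀⌋ : ℤ) : ℝ) by linarith, Int.fract_sub_intCast]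
  have hwinj : ∀ u ∈ S, ∀ u' ∈ S, w u = w u' → u = u' := by
    intro u hu u' hu' h
    have e : φ (u, 0) = φ (u', 0) := by rw [← hcross u hu, ← hcross u' hu', h]
    obtain ⟨-, n, hn⟩ := chart_eq_iff hφ1 hφi (p := (u, 0)) (p' := (u', 0)) h00 h00 e
    have hn0 : n = 0 := int_eq_zero_of_abs_cast_lt_one (abs_lt.2 ⟨by
      have := (hS u hu).2; have := (hS u' hu').1; simp only at hn; linarith, by
      have := (hS u hu).1; have := (hS u' hu').2; simp only at hn; linarith⟩)
    rw [hn0] at hn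
    simp only [Int.cast_zero, add_zero] at hn
    exact hn.symm
  -- (iii) the shifted level loop `L` and `crossingNumber φ b = crossingNumber φ L`
  obtain ⟨L, hL, hLt⟩ := exists_coreCircle hψc hψ1 u₀ k 1 (Or.inl rfl)
  have hLt' : ∀ t : ℝ, L (circlePt t) = ψ (u₀ + t, k) := fun t => by rw [hLt, one_mul]
  have hLc : ∀ θ, L θ ∈ page g c := fun θ => by
    obtain ⟨t, rfl⟩ := circleParam_surjective θ
    show L (circlePt t) ∈ page g c
    rw [hLt']; exact hψp _
  have hbL : crossingNumber φ b = crossingNumber φ L := by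
    refine crossingNumber_eq_of_loop_family hc hφc hφ1 hφp hφi hb (core_mem_page hψb hψp) hL hLc
      (fun s t => ψ (s * u₀ + t, s * k)) ?_ (fun s _ t _ => hψp _) (fun s _ => ?_) (fun t _ => ?_)
      (fun t _ => ?_)
    · exact (hψc.comp (((continuous_fst.mul continuous_const).add continuous_snd).prodMk
        (continuous_fst.mul continuous_const))).continuousOn
    · show ψ (s * u₀ + 0, s * k) = ψ (s * u₀ + 1, s * k)
      rw [add_zero, hψ1]
    · show ψ (0 * u₀ + t, 0 * k) = b (circlePt t)
      rw [zero_mul, zero_mul, zero_add, hψb]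
    · show ψ (1 * u₀ + t, 1 * k) = L (circlePt t)
      rw [one_mul, one_mul, hLt']
  -- (iv) on the `φ`-side: the level `0` of `g v = height φ (L e^{2πiv})` is regular with solutions
  -- `S' = w '' S`
  have hgL : (fun v => height φ (L (circlePt v))) = fun v => height φ (ψ (u₀ + v, k)) :=
    funext fun v => by rw [hLt']
  have hlev' : ∀ v ∈ Icc (0 : ℝ) 1, (L (circlePt v) ∈ φ '' (univ ×ˢ Ioo (-1 : ℝ) 1) ∧
      height φ (L (circlePt v)) = 0) ↔ v ∈ S.image w := by
    intro v hv
    rw [hLt', Finset.mem_image]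
    constructor
    · rintro ⟨hA, hh⟩
      obtain ⟨hq2, hqφ⟩ := prelift_spec hA
      have hq0 : (prelift φ (ψ (u₀ + v, k))).2 = 0 := hh
      have e1 : φ ((prelift φ (ψ (u₀ + v, k))).1, 0) = ψ (u₀ + v, k) := by rw [← hq0]; exact hqφ
      set u := Int.fract (prelift φ (ψ (u₀ + v, k))).1 with hu
      have hu01 : u ∈ Icc (0 : ℝ) 1 := ⟨Int.fract_nonneg _, (Int.fract_lt_one _).le⟩
      have e2 : φ (u, 0) = ψ (u₀ + v, k) := by
        rw [← e1]; exact chart_fract hφ1 ((prelift φ (ψ (u₀ + v, k))).1, 0)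
      have huS : u ∈ S := by
        refine (hlev u hu01).1 ⟨?_, ?_⟩
        · rw [e2]; exact ⟨(u₀ + v, k), ⟨trivial, hk1⟩, rfl⟩
        · rw [e2]; exact height_of_lift hψ1 hψi hk1
      refine ⟨u, huS, ?_⟩
      have e3 : ψ (u₀ + w u, k) = ψ (u₀ + v, k) := by rw [hcross u huS, e2]
      obtain ⟨-, n, hn⟩ := chart_eq_iff hψ1 hψi (p := (u₀ + w u, k)) (p' := (u₀ + v, k)) hk1 hk1 e3
      simp only at hn
      have hn0 : n = 0 := int_eq_zero_of_abs_cast_lt_one (abs_lt.2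
        ⟨by linarith [hv.1, (hwI u huS).2], by linarith [hv.2, (hwI u huS).1]⟩)
      rw [hn0, Int.cast_zero, add_zero] at hn
      linarith
    · rintro ⟨u, hu, rfl⟩
      rw [hcross u hu]
      exact ⟨⟨(u, 0), ⟨trivial, h00⟩, rfl⟩, height_of_lift hφ1 hφi h00⟩
  have hreg' : ∀ v ∈ S.image w, ContDiffAt ℝ 1 (fun v => height φ (L (circlePt v))) v ∧
      deriv (fun v => height φ (L (circlePt v))) v ≠ 0 := by
    intro v hv
    obtain ⟨u, hu, rfl⟩ := Finset.mem_image.1 hv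
    have hcp : φ (u, 0) = ψ (u₀ + w u, k) := (hcross u hu).symm
    rw [hgL]
    constructor
    · obtain ⟨T, -, -, -, hT⟩ := contDiffAt_height_comp_chart hc hψs hψp hφs hφ1 hφp hφi hφo
        (p₀ := (u₀ + w u, k)) (q₀ := (u, 0)) h00 hcp.symm
      have hline : ContDiff ℝ ∞ (fun v : ℝ => ((u₀ + v, k) : ℝ × ℝ)) := by fun_prop
      have h := hT.comp (w u) hline.contDiffAt
      exact h.of_le (m := 1) (by norm_cast)
    · have hd := deriv_comp_const_add (fun v => height φ (ψ (v, k))) u₀ (w u)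
      beta_reduce at hd
      rw [hd]
      have hsg := helper_crossing_signs g c hc φ ψ hφs hφ1 hφp hφi hφo hψs hψ1 hψp hψi hψo u
        (u₀ + w u) k hk1 hcp
      exact fun h0 => (hreg u hu).2 (hsg.2.2.1 h0)
  have hS' : ∀ v ∈ S.image w, v ∈ Ioo (0 : ℝ) 1 := fun v hv => by
    obtain ⟨u, hu, rfl⟩ := Finset.mem_image.1 hv
    exact hwI u hu
  have hcountL := crossingNumber_eq_sum_sign hc hφc hφ1 hφp hφi hL hLc (k := 0) (by norm_num)
    (S.image w) hS' hlev' hreg'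
  -- (v) the sign rule at each crossing, and the summation
  rw [hbL, hcountL, hcountA, Finset.sum_image hwinj, ← Finset.sum_neg_distrib]
  refine Finset.sum_congr rfl fun u hu => ?_
  have hcp : φ (u, 0) = ψ (u₀ + w u, k) := (hcross u hu).symm
  have hsg := helper_crossing_signs g c hc φ ψ hφs hφ1 hφp hφi hφo hψs hψ1 hψp hψi hψo u
    (u₀ + w u) k hk1 hcp
  have hd : deriv (fun v => height φ (L (circlePt v))) (w u) =
      deriv (fun v => height φ (ψ (v, k))) (u₀ + w u) := by
    rw [hgL]
    have h := deriv_comp_const_add (fun v => height φ (ψ (v, k))) u₀ (w u)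
    beta_reduce at h
    exact h
  rw [hd]
  exact ite_sign_eq_neg hsg (hreg u hu).2

/-! ## The registered form -/

/-- **Sub-goal `helper_crossingNumber_symm`** (X7-3 = (R1) SYMMETRY of Z6 §3, the last missing
piece of the missing lemma `crossingNumber_eq_stdSymp` of node N1a of NF4): for two page curves
`a`, `b` of `page g c` with annulus charts `φ`, `ψ` satisfying the six hypotheses of node N1a,
`crossingNumber φ b = −crossingNumber ψ a`. [cite: FarbMargalit2012, §6.1] -/
theorem helper_crossingNumber_symm : ∀ (g : ℕ) (c : ℂ) (_hc : ‖c‖ = 1) (a b : Metric.sphere (0 : EuclideanSpace ℝ (Fin 2)) 1 → Literature.Topology.FourManifolds.LefschetzBase.Base g) (φ ψ : ℝ × ℝ → Literature.Topology.FourManifolds.LefschetzBase.Base g), Continuous a → Continuous b → ContMDiff 𝓘(ℝ, ℝ × ℝ) (𝓡∂ 4) ∞ φ → (∀ u r, φ (u + 1, r) = φ (u, r)) → (∀ u, φ (u, 0) = a (Literature.Topology.FourManifolds.circlePt u)) → (∀ p, φ p ∈ Literature.Topology.FourManifolds.LefschetzBase.page g c) → Set.InjOn φ (Set.Ico (0 :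 ℝ) 1 ×ˢ Set.Ioo (-1 : ℝ) 1) → (∀ u r, r ∈ Set.Ioo (-1 : ℝ) 1 → 0 < inner ℝ (deriv (fun r' => (φ (u, r')).1) r) (Literature.Topology.FourManifolds.LefschetzBase.cplxJ (deriv (fun u' => (φ (u', r)).1) u))) → ContMDiff 𝓘(ℝ, ℝ × ℝ) (𝓡∂ 4) ∞ ψ → (∀ u r, ψ (u + 1, r) = ψ (u, r)) → (∀ u, ψ (u, 0) = b (Literature.Topology.FourManifolds.circlePt u)) → (∀ p, ψ p ∈ Literature.Topology.FourManifolds.LefschetzBase.page g c) → Set.InjOn ψ (Set.Ico (0 : ℝ) 1 ×ˢ Set.Ioo (-1 : ℝ) 1) → (∀ u r, r ∈ Set.Ioo (-1 : ℝ) 1 → 0 < inner ℝ (deriv (fun r' => (ψ (u, r')).1) r) (Literature.Topology.FourManifolds.LefschetzBase.cplxJ (deriv (fun u' => (ψ (u', r)).1) u))) → Summit.SmoothPoincare4.SmoothPoincare4.Theorems.AcyclicBisectionExists.ModpBraidOrbits.crossingNumber φ b = -Summit.SmoothPoincare4.SmoothPoincare4.Theorems.AcyclicBisectionExists.ModpBraidOrbits.crossingNumber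 ψ a :=
  fun _ _ hc _ _ _ _ ha hb hφs hφ1 hφa hφp hφi hφo hψs hψ1 hψb hψp hψi hψo =>
    crossingNumber_symm hc ha hb hφs hφ1 hφa hφp hφi hφo hψs hψ1 hψb hψp hψi hψo

end Summit.SmoothPoincare4.SmoothPoincare4.Theorems.AcyclicBisectionExists.ModpBraidOrbits

end
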